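import Literature.NumberTheory.EllipticCurves.QuadraticTwistRank
import Literature.NumberTheory.EllipticCurves.RegulatorBasisProofs
import Literature.NumberTheory.EllipticCurves.RegulatorProofs
import Literature.NumberTheory.EllipticCurves.MordellWeilTheoremProofs
import Literature.NumberTheory.EllipticCurves.HeightsBaseChangeProofs
import Literature.NumberTheory.EllipticCurves.BSDInvariantsRegulatorProofs
import Literature.NumberTheory.EllipticCurves.BSDInvariantsProofs
import Summits.BirchSwinnertonDyer.Uniform.U2.GenusCongruence
import HarnessLib

/-!
# Track U2 (cell `bsd-uniform`, seat u2-p1): the INDEX LEMMA (L5) engine — heights of odd multiples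
# descended along a quadratic extension: `k²·ĥ_K(Q') = 2·a²·Reg(E/ℚ)` with `a, k` ODD

HONEST FRAMING (cell `bsd-uniform`, HOME run/shared/lean/pub/bsd-uniform/, verbatim in every file of
the seat): a RELATIVE ("twist-transport") theorem, uniform in the twisting parameter `d`, CONDITIONAL
on NAMED binders of two provenances (referee V17 C2-F1): PER BASE — `BSD₂(E) ∧ BSD₂(E^{(D)})`
(`hbsd`/`hbsd₀`), `Ш(E)[2] = Ш(E^{(D)})[2] = 0` (`hSha`/`hSha₀`), `r_an = 1 / 0` (`hr`/`hr₀`), (H-y)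
`y_K ∉ 2E(K)` (`hHy`), `c(E)` odd (`hc`); PER TWIST PAIR `(E^{(d)}, E^{(d·d_K)})` — the (※) identity
with odd indices `n, m` (`hId`) and the rank-`0` member's Zhai unit (`hZhai`); until each PER-TWIST-PAIR
binder is a tree theorem from base invariants, every transported pair is CERTIFICATE-DERIVED in that
binder, whatever the base. It converts PAIRS, never the class X5; books nothing; moves no census
number; no per-curve certificate is counted as a uniform theorem.

THIS FILE (support, theorems only; no `def`, no named fact) is the algebraic/height-theoretic engine of
the index lemma L5 of `p2/idea-2/T4-PROOF.md` (`ĥ_K(y_K) = 2m²·Reg(E)`, `m` odd; `ĥ_K(P(χ)) =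
2n²·Reg(E^{(d)})`, `n` odd), the input `hL5χ`/`hL51` of `CorC.gzQuotient_identity` from which the
(※) identity `hId` of the U2 heads is assembled. Everything is PROVED from the tree's Néron–Tate /
Mordell–Weil / regulator theorems (`HeightsProofs`, `HeightsBaseChangeProofs`, `RegulatorBasisProofs`,
`MordellWeilTheoremProofs`, `QuadraticTwistRank`):
* §1 rank one: for `V/F` of Mordell–Weil rank `1`, every `Q ∈ V(F)` is `a·g + T` (`T` torsion, `g` a
  Mordell–Weil basis) and `ĥ(Q) = a²·Reg(V/F)`;
* §2 parity bookkeeping in a group without `2`-torsion;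
* §3 descent of ODD multiples along a quadratic extension `K = F(θ)`: if `rank V(K) = rank V(F)` and
  `V(K)[2] = 0`, every `Q' ∈ V(K)` has an ODD multiple `k·Q'` coming from `V(F)` (rank count:
  `V(K)/V(F)` is torsion; halving preserves `F`-rationality since `σR − R ∈ V(K)[2] = 0`);
* §4 over `ℚ`: for `V/ℚ` with a model `V₁` of Mordell–Weil rank `1`, `K` a quadratic field with
  `rank V^{(d_K)}(ℚ) = 0` and `V(K)[2] = 0`, and `Q' ∈ V(K)` NOT twice a point of `V(K)`:
  `k²·ĥ_K(Q') = 2·a²·Reg(V₁)` with `a, k` ODD natural numbers (`ĥ_K = 2ĥ_ℚ` on `V(ℚ)`; Silverman,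
  AEC Exercise 10.16 for the ranks).

References: Silverman AEC VIII.9.3, VIII.6, X.2 / Exercise 10.16 [SilvermanAEC2009]; Gross 2011
§4 (regulator) [Gross2011]; Gross–Zagier 1986 I.(6.3)–(6.5) (`ĥ_K` normalisation) [GrossZagier1986];
`p2/idea-2/T4-PROOF.md` v1.9b L5 (evidence).
-/

noncomputable section

open scoped Classical

open Module WeierstrassCurve WeierstrassCurve.Affine.Point

namespace Summit.BirchSwinnertonDyer.Uniform.U2.HeegnerIndex

universe u v

/-! ## §1 Rank one: `Q = a·g + T` and `ĥ(Q) = a²·Reg` -/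

section RankOne

variable {F : Type*} [Field F] [NumberField F] (V : WeierstrassCurve F) [V.IsElliptic]

/-- Translating by a torsion point does not change the canonical height: `ĥ(P + T) = ĥ(P)`
(`⟨·,·⟩` kills torsion, Silverman AEC VIII.9.3(c)(d)). [cite: SilvermanAEC2009, Thm. VIII.9.3(c)-(d)] -/
theorem canonicalHeight_add_of_isOfFinAddOrder (P : V.toAffine.Point) {T : V.toAffine.Point}
    (hT : IsOfFinAddOrder T) : canonicalHeight (P + T) = canonicalHeight P := by
  rw [← heightPairing_self_holds (P + T), ← heightPairing_self_holds P,
    heightPairing_add_of_isOfFinAddOrder_left P hT, heightPairing_add_right,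
    heightPairing_eq_zero_of_isOfFinAddOrder_right P hT, add_zero]

/-- **Rank one.** If `rank_ℤ V(F) = 1`, every `Q ∈ V(F)` is `Q = a·g + T` with `T` torsion and `g` a
Mordell–Weil basis, and `ĥ(Q) = a² · Reg(V/F)` (`Reg = det⟨g,g⟩ = ĥ(g)`, Silverman AEC VIII.9 /
Gross 2011 §4; Mordell–Weil basis `exists_isMordellWeilBasis_holds`).
[cite: SilvermanAEC2009, Thm. VIII.9.3 and §VIII.9 (regulator)] [cite: Gross2011, §4] -/
theorem exists_eq_zsmul_add_of_rank_one (hrk : V.mordellWeilRank = 1) (Q : V.toAffine.Point) :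
    ∃ (a : ℤ) (g T : V.toAffine.Point), IsOfFinAddOrder T ∧ Q = a • g + T ∧
      canonicalHeight Q = (a : ℝ) ^ 2 * V.regulator := by
  obtain ⟨P, hP⟩ := exists_isMordellWeilBasis_holds (W := V)
  haveI : Subsingleton (Fin V.mordellWeilRank) := by rw [hrk]; infer_instance
  let i₀ : Fin V.mordellWeilRank := ⟨0, by omega⟩
  have hrange : Set.range (QuotientAddGroup.mk ∘ P : Fin V.mordellWeilRank → mordellWeilModTorsion V) =
      {QuotientAddGroup.mk (P i₀)} := by
    ext z
    simp only [Set.mem_range, Set.mem_singleton_iff, Function.comp_apply]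
    constructor
    · rintro ⟨i, rfl⟩; rw [Subsingleton.elim i i₀]
    · rintro rfl; exact ⟨i₀, rfl⟩
  have hQ : (QuotientAddGroup.mk Q : mordellWeilModTorsion V) ∈
      Submodule.span ℤ (Set.range (QuotientAddGroup.mk ∘ P :
        Fin V.mordellWeilRank → mordellWeilModTorsion V)) := by
    rw [hP.2]; trivial
  rw [hrange, Submodule.mem_span_singleton] at hQ
  obtain ⟨a, ha⟩ := hQ
  have hT : IsOfFinAddOrder (Q - a • P i₀) := by
    have h0 : (QuotientAddGroup.mk (Q - a • P i₀) : mordellWeilModTorsion V) = 0 := by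
      rw [QuotientAddGroup.mk_sub, QuotientAddGroup.mk_zsmul, ha, sub_self]
    exact (AddCommGroup.mem_torsion _).mp ((QuotientAddGroup.eq_zero_iff _).mp h0)
  refine ⟨a, P i₀, Q - a • P i₀, hT, by abel, ?_⟩
  have hreg : V.regulator = canonicalHeight (P i₀) := by
    rw [← hP.regulatorOf_eq_regulator, regulatorOf, Matrix.det_eq_elem_of_subsingleton _ i₀,
      heightPairingMatrix_apply, heightPairing_self_holds]
  calc canonicalHeight Q = canonicalHeight (a • P i₀ + (Q - a • P i₀)) := by congr 1; abel
    _ = canonicalHeight (a • P i₀) := canonicalHeight_add_of_isOfFinAddOrder V _ hT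
    _ = (a : ℝ) ^ 2 * canonicalHeight (P i₀) := canonicalHeight_zsmul_holds a (P i₀)
    _ = (a : ℝ) ^ 2 * V.regulator := by rw [hreg]

end RankOne

/-! ## §2 Parity bookkeeping in a group without `2`-torsion -/

section Parity

variable {A : Type*} [AddCommGroup A]

/-- If `A` has no `2`-torsion, `k` is odd and `k·y = 2R + T` with `T` of finite order, then `y` is
twice an element of `A` (`T = 2t'`, `GenusCongruence.exists_two_nsmul_eq_of_isOfFinAddOrder`; then
`y = 2(R + t' − j·y)` for `k = 2j + 1`). [folklore] -/
theorem exists_two_nsmul_eq_of_odd_smul_eq (h2 : ∀ a : A, (2 : ℕ) • a = 0 → a = 0) {k : ℕ}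
    (hk : Odd k) {y R T : A} (hT : IsOfFinAddOrder T) (h : (k : ℤ) • y = (2 : ℕ) • R + T) :
    ∃ R' : A, (2 : ℕ) • R' = y := by
  obtain ⟨t, -, ht⟩ := GenusCongruence.exists_two_nsmul_eq_of_isOfFinAddOrder h2 hT
  obtain ⟨j, rfl⟩ := hk
  refine ⟨R + t - (j : ℤ) • y, ?_⟩
  have h' : ((2 * j + 1 : ℕ) : ℤ) • y = (2 : ℕ) • R + (2 : ℕ) • t := by rw [h, ht]
  have e : ((2 * j + 1 : ℕ) : ℤ) • y = (2 : ℕ) • ((j : ℤ) • y) + y := by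
    rw [show ((2 * j + 1 : ℕ) : ℤ) = 2 * (j : ℤ) + 1 by push_cast; ring, add_zsmul, one_zsmul,
      mul_zsmul, two_zsmul, two_nsmul]
  rw [e] at h'
  rw [nsmul_sub, nsmul_add]
  have := h'
  -- `2(jy) + y = 2R + 2t` ⇒ `y = 2R + 2t - 2(jy)`
  calc (2 : ℕ) • R + (2 : ℕ) • t - (2 : ℕ) • ((j : ℤ) • y)
      = ((2 : ℕ) • ((j : ℤ) • y) + y) - (2 : ℕ) • ((j : ℤ) • y) := by rw [h']
    _ = y := by abel

/-- The contrapositive form used for parities: if `y` is NOT twice an element, then no odd multiple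
`k·y` lies in `2A + A_tors`. [folklore] -/
theorem not_exists_odd_smul_eq (h2 : ∀ a : A, (2 : ℕ) • a = 0 → a = 0) {y : A}
    (hy : ¬ ∃ R : A, (2 : ℕ) • R = y) {k : ℕ} (hk : Odd k) :
    ¬ ∃ R T : A, IsOfFinAddOrder T ∧ (k : ℤ) • y = (2 : ℕ) • R + T := by
  rintro ⟨R, T, hT, h⟩
  exact hy (exists_two_nsmul_eq_of_odd_smul_eq h2 hk hT h)

end Parity

/-! ## §3 Descent of odd multiples along a quadratic extension `K = F(θ)` -/

section Quadratic

open WeierstrassCurve.QuadraticDescent Literature.NumberTheory.QuadraticFields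

variable {F K : Type u} [Field F] [Field K] [Algebra F K] [NeZero (2 : F)]
  (V : WeierstrassCurve F) (h2 : finrank F K = 2) {θ : K} {c : F}
  (hθ : θ ∉ Set.range (algebraMap F K)) (hc : θ ^ 2 = algebraMap F K c)

include h2 hθ hc in
/-- **Halving preserves `F`-rationality** when `V(K)[2] = 0`: if `2Y ∈ ι(V(F))` then `Y ∈ ι(V(F))`
(apply the conjugation `σ` of `K/F`: `2(σY − Y) = 0`, so `σY = Y`, so the coordinates of `Y` lie in
`F`). [cite: SilvermanAEC2009, X.2 and Exercise 10.16] -/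
theorem mem_range_incl_of_two_nsmul_mem
    (h2V : ∀ P : (V.baseChange K).toAffine.Point, (2 : ℕ) • P = 0 → P = 0)
    {Y : (V.baseChange K).toAffine.Point} (hY : (2 : ℕ) • Y ∈ (incl K V).range) :
    Y ∈ (incl K V).range := by
  set σ := Quadratic.conj h2 hθ hc with hσdef
  obtain ⟨Q, hQ⟩ := hY
  have hfix : conjMap V σ ((2 : ℕ) • Y) = (2 : ℕ) • Y := by rw [← hQ]; exact conjMap_incl V σ Q
  have hYfix : conjMap V σ Y = Y := by
    have h0 : (2 : ℕ) • (conjMap V σ Y - Y) = 0 := by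
      rw [nsmul_sub, ← map_nsmul, hfix, sub_self]
    exact sub_eq_zero.mp (h2V _ h0)
  rcases Y with _ | ⟨x, y, h⟩
  · exact ⟨0, by rw [_root_.map_zero]; rfl⟩
  · rw [Affine.Point.map_some, Affine.Point.some.injEq] at hYfix
    obtain ⟨a, ha⟩ := Quadratic.exists_eq_algebraMap_of_conj_eq h2 hθ hc hYfix.1
    obtain ⟨b, hb⟩ := Quadratic.exists_eq_algebraMap_of_conj_eq h2 hθ hc hYfix.2
    obtain ⟨Q, hQ⟩ := exists_incl_eq V h ha.symm hb.symm
    exact ⟨Q, hQ⟩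

include h2 hθ hc in
/-- By induction: `2^e · Y ∈ ι(V(F)) ⇒ Y ∈ ι(V(F))` when `V(K)[2] = 0`. [folklore] -/
theorem mem_range_incl_of_two_pow_nsmul_mem
    (h2V : ∀ P : (V.baseChange K).toAffine.Point, (2 : ℕ) • P = 0 → P = 0) (e : ℕ)
    {Y : (V.baseChange K).toAffine.Point} (hY : (2 ^ e : ℕ) • Y ∈ (incl K V).range) :
    Y ∈ (incl K V).range := by
  induction e generalizing Y with
  | zero => simpa using hY
  | succ e ih =>
    apply ih
    apply mem_range_incl_of_two_nsmul_mem V h2 hθ hc h2V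
    rwa [← mul_nsmul', ← pow_succ']

include h2 hθ hc in
/-- **Descent of ODD multiples along `K = F(θ)`.** If `V(K)` is finitely generated with
`rank_ℤ V(K) = rank_ℤ V(F)` and `V(K)[2] = 0`, then every `Q' ∈ V(K)` has an ODD multiple in the image
of `V(F)`: `k · Q' = ι(Q)`, `k` odd (`V(K)/ι(V(F))` has rank `0`, hence is torsion; strip the powers of
`2` with `mem_range_incl_of_two_pow_nsmul_mem`). [cite: SilvermanAEC2009, Exercise 10.16] -/
theorem exists_odd_smul_eq_incl [Module.Finite ℤ (V.baseChange K).toAffine.Point]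
    (h2V : ∀ P : (V.baseChange K).toAffine.Point, (2 : ℕ) • P = 0 → P = 0)
    (hrank : (V.baseChange K).mordellWeilRank = V.mordellWeilRank)
    (Q' : (V.baseChange K).toAffine.Point) :
    ∃ k : ℕ, Odd k ∧ ∃ Q : V.toAffine.Point, (k : ℤ) • Q' = incl K V Q := by
  unfold mordellWeilRank at hrank
  set ιₗ := (incl K V).toIntLinearMap with hι
  have hιinj : Function.Injective ιₗ := incl_injective V
  set N : Submodule ℤ (V.baseChange K).toAffine.Point := LinearMap.range ιₗ with hN
  -- `V(F)` is finitely generated (it embeds into `V(K)`), ranks are finite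
  haveI : Module.Finite ℤ V.toAffine.Point := Module.Finite.of_injective ιₗ hιinj
  have hrkN : Module.rank ℤ N = Module.rank ℤ V.toAffine.Point :=
    (LinearEquiv.ofInjective ιₗ hιinj).rank_eq.symm
  have hRN := Submodule.rank_quotient_add_rank N
  have hM : Module.rank ℤ (V.baseChange K).toAffine.Point = (finrank ℤ (V.baseChange K).toAffine.Point : Cardinal) :=
    (Module.finrank_eq_rank ℤ _).symm
  have hF : Module.rank ℤ V.toAffine.Point = (finrank ℤ V.toAffine.Point : Cardinal) :=
    (Module.finrank_eq_rank ℤ _).symm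
  rw [hrkN, hM, hF, hrank] at hRN
  -- the quotient has rank `0`, hence is torsion
  have hq0 := (Cardinal.add_eq_right_iff.mp hRN).resolve_left fun h =>
    (Cardinal.natCast_lt_aleph0 (n := finrank ℤ V.toAffine.Point)).not_ge ((le_max_left _ _).trans h)
  have htors := rank_eq_zero_iff_isTorsion.mp hq0
  obtain ⟨⟨n, hn⟩, hnQ⟩ := @htors (Submodule.Quotient.mk Q')
  have hn0 : n ≠ 0 := nonZeroDivisors.ne_zero hn
  have hmem : n • Q' ∈ N := by
    rw [← Submodule.Quotient.mk_eq_zero, Submodule.Quotient.mk_smul]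
    exact hnQ
  -- pass to the natural number `|n| = 2^e · k`, `k` odd
  have hmem' : n.natAbs • Q' ∈ N := by
    rcases Int.natAbs_eq n with h | h
    · rw [← natCast_zsmul, ← h]; exact hmem
    · rw [← natCast_zsmul, show (n.natAbs : ℤ) = -n by omega, neg_zsmul]; exact N.neg_mem hmem
  obtain ⟨e, k, hk, hek⟩ := Nat.exists_eq_two_pow_mul_odd (Int.natAbs_ne_zero.mpr hn0)
  rw [hek, mul_comm, mul_nsmul] at hmem'
  have hmemk : (k • Q') ∈ (incl K V).range := by
    apply mem_range_incl_of_two_pow_nsmul_mem V h2 hθ hc h2V e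
    obtain ⟨Q, hQ⟩ := hmem'
    exact ⟨Q, hQ⟩
  obtain ⟨Q, hQ⟩ := hmemk
  exact ⟨k, hk, Q, by rw [natCast_zsmul]; exact hQ.symm⟩

omit [NeZero (2 : F)] in
/-- Parity transport through `ι`: if `k·Q' = ι(Q)` and `Q = a·g + T` with `a` EVEN and `T` torsion,
then `k·Q' ∈ 2V(K) + V(K)_tors`. [folklore] -/
theorem exists_eq_two_nsmul_add_of_even {Q' : (V.baseChange K).toAffine.Point} {k : ℕ}
    {Q : V.toAffine.Point} (hkQ : (k : ℤ) • Q' = incl K V Q) {a : ℤ} {g T : V.toAffine.Point}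
    (hT : IsOfFinAddOrder T) (hQ : Q = a • g + T) (ha : Even a) :
    ∃ R T' : (V.baseChange K).toAffine.Point, IsOfFinAddOrder T' ∧
      (k : ℤ) • Q' = (2 : ℕ) • R + T' := by
  obtain ⟨a', rfl⟩ := ha
  refine ⟨incl K V (a' • g), incl K V T, (incl K V).isOfFinAddOrder hT, ?_⟩
  rw [hkQ, hQ, map_add, map_zsmul, map_zsmul, two_nsmul, ← add_zsmul]

end Quadratic

/-! ## §4 Over `ℚ`: `k²·ĥ_K(Q') = 2·a²·Reg(V₁)` with `a, k` odd -/

section Rat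

open WeierstrassCurve.QuadraticDescent Literature.NumberTheory.QuadraticFields

/-- **THE INDEX-LEMMA ENGINE (L5, ℚ-level).** Let `V/ℚ` be elliptic with a model `V₁` (`C • V₁ = V`)
of Mordell–Weil rank `1`, `K` a quadratic number field with `rank V^{(d_K)}(ℚ) = 0` and
`V(K)[2] = 0`, and `Q' ∈ V(K)` NOT twice a point of `V(K)`. Then there are ODD natural numbers `a, k`
with `k² · ĥ_K(Q') = 2 · a² · Reg(V₁)` (`ĥ_K` the height relative to `K`, `Reg` the regulator over
`ℚ`): `rank V(K) = rank V(ℚ) + rank V^{(d_K)}(ℚ) = 1` (Silverman AEC Exercise 10.16, tree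
`mordellWeilRank_baseChange_of_finrank_eq_two_of_finite`), so an odd multiple `k·Q' = ι(Q)` comes
from `V(ℚ)` (§3), `Q = a·g + T` with `ĥ_ℚ(Q) = a²·Reg` (§1), `ĥ_K(ι Q) = 2ĥ_ℚ(Q)`
(`canonicalHeight_baseChange`), and `a` is odd because `Q'` is not twice a point (§2).
[cite: SilvermanAEC2009, Exercise 10.16 and Thm. VIII.9.3] [cite: GrossZagier1986, I.(6.3)–(6.5) (ĥ_K = 2ĥ_ℚ on E(ℚ))] -/
theorem exists_odd_sq_mul_canonicalHeight_eq (V V₁ : WeierstrassCurve ℚ) [V.IsElliptic] [V₁.IsElliptic]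
    (hV₁ : ∃ C : VariableChange ℚ, C • V₁ = V)
    (K : Type) [Field K] [NumberField K] (hK2 : finrank ℚ K = 2)
    (hrk : V₁.mordellWeilRank = 1)
    (hrk₀ : (V.quadraticTwist (NumberField.discr K : ℚ)).mordellWeilRank = 0)
    (h2K : ∀ P : (V.baseChange K).toAffine.Point, (2 : ℕ) • P = 0 → P = 0)
    (Q' : (V.baseChange K).toAffine.Point)
    (hQ' : ¬ ∃ R : (V.baseChange K).toAffine.Point, (2 : ℕ) • R = Q') :
    ∃ a k : ℕ, Odd a ∧ Odd k ∧
      ((k : ℝ) ^ 2 * canonicalHeight Q' = 2 * (a : ℝ) ^ 2 * V₁.regulator) := by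
  obtain ⟨C, hC⟩ := hV₁
  -- rank and regulator of `V` from the model `V₁`
  have hrkV : V.mordellWeilRank = 1 := by
    rw [← hC, mordellWeilRank_variableChange_holds V₁ C]; exact hrk
  have hregV : V.regulator = V₁.regulator := by
    rw [← hC]; exact regulator_variableChange_holds V₁ C
  -- Mordell–Weil over `K` and the rank count `rank V(K) = rank V(ℚ) + rank V^{(d_K)}(ℚ) = rank V(ℚ)`
  haveI : (V.baseChange K).IsElliptic := inferInstanceAs (V.map (algebraMap ℚ K)).IsElliptic
  haveI : Module.Finite ℤ (V.baseChange K).toAffine.Point :=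
    module_finite_point_holds (W := V.baseChange K)
  have hrank : (V.baseChange K).mordellWeilRank = V.mordellWeilRank := by
    rw [V.mordellWeilRank_baseChange_of_finrank_eq_two_of_finite K hK2, hrk₀, add_zero]
  -- a square-root generator of `K/ℚ`
  obtain ⟨θ, c, hθ, hc⟩ := Quadratic.exists_sq_eq_algebraMap (F := ℚ) (K := K) hK2
  -- an odd multiple of `Q'` comes from `V(ℚ)`
  obtain ⟨k, hk, Q, hkQ⟩ := exists_odd_smul_eq_incl V hK2 hθ hc h2K hrank Q'
  -- `Q = a·g + T`, `ĥ_ℚ(Q) = a²·Reg(V)`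
  obtain ⟨a, g, T, hT, hQ, hhQ⟩ := exists_eq_zsmul_add_of_rank_one V hrkV Q
  -- `a` is odd
  have ha : Odd a := by
    by_contra hev
    rw [Int.not_odd_iff_even] at hev
    exact not_exists_odd_smul_eq h2K hQ' hk (exists_eq_two_nsmul_add_of_even V hkQ hT hQ hev)
  -- heights: `k²·ĥ_K(Q') = ĥ_K(k·Q') = ĥ_K(ι Q) = 2·ĥ_ℚ(Q) = 2·a²·Reg`
  have h1 : canonicalHeight ((k : ℤ) • Q') = ((k : ℤ) : ℝ) ^ 2 * canonicalHeight Q' :=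
    canonicalHeight_zsmul_holds (k : ℤ) Q'
  have h2 : canonicalHeight (incl K V Q) = (finrank ℚ K : ℝ) * canonicalHeight Q :=
    canonicalHeight_baseChange (R := ℚ) (K := ℚ) (L := K) Q
  refine ⟨a.natAbs, k, Int.natAbs_odd.mpr ha, hk, ?_⟩
  have hak : ((a.natAbs : ℕ) : ℝ) ^ 2 = (a : ℝ) ^ 2 := by
    rw [Nat.cast_natAbs, Int.cast_abs, sq_abs]
  have hK2' : ((finrank ℚ K : ℕ) : ℝ) = 2 := by exact_mod_cast hK2
  rw [hak, ← hregV, mul_assoc, ← hhQ, ← hK2', ← h2, ← hkQ, h1]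
  push_cast
  ring

end Rat

end Summit.BirchSwinnertonDyer.Uniform.U2.HeegnerIndex

end
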